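import Summits.ResolutionOfSingularities.ResolutionOfSingularities.Theorems.FrobeniusLadderFInjectiveMacaulayficationHFedderCertificates
import Summits.ResolutionOfSingularities.ResolutionOfSingularities.Theorems.FrobeniusLadderFInjectiveMacaulayficationClauseOfPderivNotMem
import Summits.ResolutionOfSingularities.ResolutionOfSingularities.Theorems.FrobeniusLadderFInjectiveMacaulayficationGradedConeFiModel
import Literature.AlgebraicGeometry.Resolution.ResolutionOfSingularities
import Mathlib.Algebra.MvPolynomial.PDeriv
import Mathlib.Algebra.CharP.Lemmas
import HarnessLib

/-!
# `h = X₂² + X₃²(X₁⁶ + X₀³) + X₀²X₃³` at `p = 5`: the off-origin clause, and ONE weighted blow-up modulo the graded engine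
# (crux `FInjectiveMacaulayfication`, line `graded-engine` §16, calibration G6c)

Support file for crux stmt-ResolutionOfSingularities-15315 (`FrobeniusLadder.FInjectiveMacaulayfication`), chain w45a,
seat res-L1-w45a-stub-3. [OURS · L1 W4.5a, CRUX-PLAN v3 §C, calibration G6c] — NOT a statement of the manuscript;
AI-written, weaker than expert review.

G6c is the first calibration of the graded engine G4/G5 at a NON-ISOLATED singular point (tri-1 F4, tri-2 F10: `p = 5`,
weights `w = (2,1,5,2)` with `w₂ = 5 = p`, so every μ-cover route is wild). This file assembles the engine's off-origin
hypothesis `hoff` for `R = k[X]/(h)` at `p = 5` and states the model modulo G5: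

* `h_offOrigin_clause_char5` — at EVERY maximal ideal `Q` of `k[X]/(h)` missing some `x̄ⱼ` the local ring satisfies the
  Cohen–Macaulay + Frobenius-closed clause. Case analysis on `P = Q ∩ k[X]`:
  `X₂ ∉ P` ⇒ `∂₂h = 2X₂ ∉ P` (Jacobian, `ClauseOfPderivNotMem`); `X₂ ∈ P, X₃ ∉ P, X₁ ∉ P` ⇒ `∂₁h = 6X₁⁵X₃² ∉ P`;
  `X₂, X₁ ∈ P, X₃ ∉ P` ⇒ `X₀²X₃²(X₀ + X₃) = h - X₂² - X₃²X₁⁶ ∈ P`, so either `X₀ ∈ P` — the AXIS, Fedder certificate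
  `HFedderCertificates.clause_axis_char5` — or `X₀ ∉ P ∋ X₀ + X₃`, where `∂₀h = X₀X₃²(3X₀ + 2X₃) ∉ P`
  (`3X₀ + 2X₃ ≡ -X₃`); `X₂, X₃ ∈ P` ⇒ the PLANE, Fedder certificate `HFedderCertificates.clause_plane_char5`.
* `hGradedFiModel_char5_of_gradedEngine` — the registered statement of G5 `stub_gradedConeFiModel` (verbatim, as a
  hypothesis) implies: over every field of characteristic `5`, `Spec k[X₀,…,X₃]/(h)` has a proper birational model with
  Cohen–Macaulay F-injective domain stalks — the weighted blow-up `affineBlowup I₁₀` (`w = (2,1,5,2)`, `N = 10`,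
  `c = (5,10,2,5)`, `D = 10`), fed with `HWeightedData` (homogeneity, Veronese saturation for `N = 10`, primality,
  `x̄ⱼ ≠ 0`) and the off-origin clause above. When G5 lands this becomes unconditional by one application.

All proofs are glue on Mathlib and landed files; no definitions, no named facts. [folklore]
-/

-- single-problem summit: the doubled namespace component is forced
set_option linter.dupNamespace false

noncomputable section

open CategoryTheory AlgebraicGeometry

namespace Summit.ResolutionOfSingularities.ResolutionOfSingularities.Theorems.FInjectiveMacaulayfication.HGradedFiModel

open MvPolynomial
open Summit.ResolutionOfSingularities.ResolutionOfSingularities.Theorems.FInjectiveMacaulayfication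

/-- `2` is a unit in characteristic `5` (in any polynomial ring over the field). [folklore] -/
theorem isUnit_two_char5 (k : Type) [Field k] [CharP k 5] {σ : Type*} : IsUnit (2 : MvPolynomial σ k) := by
  have h2 : (2 : k) ≠ 0 := by
    intro h
    have h' : ((2 : ℕ) : k) = 0 := by exact_mod_cast h
    rw [CharP.cast_eq_zero_iff k 5 2] at h'
    omega
  have hu := (isUnit_iff_ne_zero.mpr h2).map (C : k →+* MvPolynomial σ k)
  rwa [map_ofNat] at hu

/-- **THE OFF-ORIGIN CLAUSE FOR `h` AT `p = 5`** (input `hoff` of the weighted / graded blow-up engines): at every maximal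
ideal `Q` of `k[X₀,…,X₃]/(h)` missing some `x̄ⱼ`, the local ring satisfies the Cohen–Macaulay + Frobenius-closed clause —
Jacobian at the regular points, Fedder certificates (`HFedderCertificates`) along the singular plane and axis.
[cite: Fedder1983, Thm. 1.12] -/
theorem h_offOrigin_clause_char5 (k : Type) [Field k] [CharP k 5] (h : MvPolynomial (Fin 4) k)
    (hh : h = MvPolynomial.X 2 ^ 2 + MvPolynomial.X 3 ^ 2 * (MvPolynomial.X 1 ^ 6 + MvPolynomial.X 0 ^ 3) +
      MvPolynomial.X 0 ^ 2 * MvPolynomial.X 3 ^ 3) :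
    ∀ (Q : Ideal (MvPolynomial (Fin 4) k ⧸ Ideal.span {h})) [Q.IsMaximal],
      (∃ j : Fin 4, Ideal.Quotient.mk (Ideal.span {h}) (MvPolynomial.X j) ∉ Q) →
      ∀ d : ℕ, ringKrullDim (Localization.AtPrime Q) = d → ∀ s : Fin d → Localization.AtPrime Q,
        (Ideal.span (Set.range s)).radical.IsMaximal →
          RingTheory.Sequence.IsWeaklyRegular (Localization.AtPrime Q) (List.ofFn s) ∧
          ∀ y : Localization.AtPrime Q, (∃ e : ℕ, y ^ 5 ^ e ∈ Ideal.span
            ((fun z : Localization.AtPrime Q => z ^ 5 ^ e) ''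
              (Ideal.span (Set.range s) : Set (Localization.AtPrime Q)))) → y ∈ Ideal.span (Set.range s) := by
  haveI : Fact (Nat.Prime 5) := ⟨Nat.prime_five⟩
  intro Q _ hj d hd s hs
  haveI hPmax : (Q.comap (Ideal.Quotient.mk (Ideal.span {h}))).IsMaximal :=
    Ideal.comap_isMaximal_of_surjective _ Ideal.Quotient.mk_surjective
  have hP := hPmax.isPrime
  have hhP : h ∈ Q.comap (Ideal.Quotient.mk (Ideal.span {h})) := by
    rw [Ideal.mem_comap, Ideal.Quotient.eq_zero_iff_mem.mpr (Ideal.mem_span_singleton_self h)]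
    exact Q.zero_mem
  have hd0 : pderiv 0 h = X 0 * X 3 ^ 2 * (3 * X 0 + 2 * X 3) := by rw [hh, HWeightedData.pderiv_zero_h]
  have hd1 : pderiv 1 h = 6 * X 1 ^ 5 * X 3 ^ 2 := by rw [hh, HWeightedData.pderiv_one_h]
  have hd2 : pderiv 2 h = 2 * X 2 := by rw [hh, HWeightedData.pderiv_two_h]
  by_cases hX2 : (X 2 : MvPolynomial (Fin 4) k) ∈ Q.comap (Ideal.Quotient.mk (Ideal.span {h})); swap
  · -- `X₂ ∉ P`: `∂₂h = 2X₂ ∉ P`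
    refine ClauseOfPderivNotMem.stub_clauseOfPderivNotMem 5 k 4 h Q 2 ?_ d hd s hs
    rw [hd2]
    exact fun hm => hX2 ((Ideal.unit_mul_mem_iff_mem _ (isUnit_two_char5 k)).mp hm)
  by_cases hX3 : (X 3 : MvPolynomial (Fin 4) k) ∈ Q.comap (Ideal.Quotient.mk (Ideal.span {h}))
  · -- the plane `X₂, X₃ ∈ P`
    exact HFedderCertificates.clause_plane_char5 k h hh Q (Ideal.mem_comap.mp hX2) (Ideal.mem_comap.mp hX3) hj
      d hd s hs
  by_cases hX1 : (X 1 : MvPolynomial (Fin 4) k) ∈ Q.comap (Ideal.Quotient.mk (Ideal.span {h})); swap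
  · -- `X₁, X₃ ∉ P`: `∂₁h = 6X₁⁵X₃² ∉ P`
    refine ClauseOfPderivNotMem.stub_clauseOfPderivNotMem 5 k 4 h Q 1 ?_ d hd s hs
    rw [hd1]
    intro hm
    rw [mul_assoc, Ideal.unit_mul_mem_iff_mem _ (HFedderCertificates.isUnit_six_char5 k)] at hm
    rcases hP.mem_or_mem hm with h1 | h3
    · exact hX1 (hP.mem_of_pow_mem 5 h1)
    · exact hX3 (hP.mem_of_pow_mem 2 h3)
  -- `X₁, X₂ ∈ P`, `X₃ ∉ P`: `X₀²X₃²(X₀ + X₃) ∈ P`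
  have hprod : (X 0 ^ 2 * X 3 ^ 2 * (X 0 + X 3) : MvPolynomial (Fin 4) k) ∈
      Q.comap (Ideal.Quotient.mk (Ideal.span {h})) := by
    have e : (X 0 ^ 2 * X 3 ^ 2 * (X 0 + X 3) : MvPolynomial (Fin 4) k) = h - X 2 * X 2 - X 3 ^ 2 * X 1 ^ 5 * X 1 := by
      rw [hh]; ring
    rw [e]
    exact Ideal.sub_mem _ (Ideal.sub_mem _ hhP (Ideal.mul_mem_left _ _ hX2)) (Ideal.mul_mem_left _ _ hX1)
  by_cases hX0 : (X 0 : MvPolynomial (Fin 4) k) ∈ Q.comap (Ideal.Quotient.mk (Ideal.span {h}))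
  · -- the axis `X₀, X₁, X₂ ∈ P`, `X₃ ∉ P`
    exact HFedderCertificates.clause_axis_char5 k h hh Q (Ideal.mem_comap.mp hX0) (Ideal.mem_comap.mp hX1)
      (Ideal.mem_comap.mp hX2) (fun h3 => hX3 (Ideal.mem_comap.mpr h3)) d hd s hs
  · -- `X₀ ∉ P`, hence `X₀ + X₃ ∈ P`, and `∂₀h = X₀X₃²(3X₀ + 2X₃) ∉ P`
    have hsum : (X 0 + X 3 : MvPolynomial (Fin 4) k) ∈ Q.comap (Ideal.Quotient.mk (Ideal.span {h})) := by
      rcases hP.mem_or_mem hprod with h03 | hs'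
      · rcases hP.mem_or_mem h03 with h0 | h3
        · exact (hX0 (hP.mem_of_pow_mem 2 h0)).elim
        · exact (hX3 (hP.mem_of_pow_mem 2 h3)).elim
      · exact hs'
    refine ClauseOfPderivNotMem.stub_clauseOfPderivNotMem 5 k 4 h Q 0 ?_ d hd s hs
    rw [hd0]
    intro hm
    rcases hP.mem_or_mem hm with h03 | hl
    · rcases hP.mem_or_mem h03 with h0 | h3
      · exact hX0 h0
      · exact hX3 (hP.mem_of_pow_mem 2 h3)
    · -- `3X₀ + 2X₃ = 3(X₀ + X₃) - X₃`
      refine hX3 ?_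
      have e : (X 3 : MvPolynomial (Fin 4) k) = 3 * (X 0 + X 3) - (3 * X 0 + 2 * X 3) := by ring
      rw [e]
      exact Ideal.sub_mem _ (Ideal.mul_mem_left _ _ hsum) hl

/-- **G6c modulo G5 — ONE WEIGHTED BLOW-UP F-INJECTIVIZES `h` AT `p = 5`, GIVEN THE GRADED ENGINE**: assuming the registered
statement of G5 `stub_gradedConeFiModel` (hypothesis `hG5`, verbatim), for every field `k` of characteristic `5` the threefold
`Spec k[X₀,…,X₃]/(X₂² + X₃²(X₁⁶ + X₀³) + X₀²X₃³)` — singular along a plane and a line, wild weight `w₂ = 5 = p` — has a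
proper birational model (the weighted blow-up of the origin, weights `(2,1,5,2)`, `affineBlowup I₁₀`, `c = (5,10,2,5)`,
`D = 10`) all of whose stalks are domains in which every system of parameters is weakly regular and generates a Frobenius
closed ideal. Inputs: `HWeightedData` (p479181) and `h_offOrigin_clause_char5`. [folklore] -/
theorem hGradedFiModel_char5_of_gradedEngine
    (hG5 : ∀ (p : ℕ) [Fact p.Prime] (k : Type) [Field k] [CharP k p] (n : ℕ) (w : Fin n → ℕ) (N D : ℕ)
      (c : Fin n → ℕ), 0 < N → (∀ v : Fin n, 0 < w v ∧ c v * w v = N) →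
      (∀ (K : ℕ) (b : Fin n →₀ ℕ), K * N ≤ Finsupp.weight w b → (MvPolynomial.monomial b (1 : k) : MvPolynomial (Fin n) k) ∈
        (Ideal.span {m : MvPolynomial (Fin n) k | ∃ b : Fin n →₀ ℕ, N ≤ Finsupp.weight w b ∧ m = MvPolynomial.monomial b 1}) ^ K) →
      ∀ (f : MvPolynomial (Fin n) k), MvPolynomial.IsWeightedHomogeneous w f D → (Ideal.span {f}).IsPrime →
      (∀ v : Fin n, Ideal.Quotient.mk (Ideal.span {f}) (MvPolynomial.X v) ≠ 0) →
      (∀ (Q : Ideal (MvPolynomial (Fin n) k ⧸ Ideal.span {f})) [Q.IsMaximal],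
        (∃ j : Fin n, Ideal.Quotient.mk (Ideal.span {f}) (MvPolynomial.X j) ∉ Q) →
        ∀ d : ℕ, ringKrullDim (Localization.AtPrime Q) = d → ∀ s : Fin d → Localization.AtPrime Q,
          (Ideal.span (Set.range s)).radical.IsMaximal →
            RingTheory.Sequence.IsWeaklyRegular (Localization.AtPrime Q) (List.ofFn s) ∧
            ∀ y : Localization.AtPrime Q, (∃ e : ℕ, y ^ p ^ e ∈ Ideal.span
              ((fun z : Localization.AtPrime Q => z ^ p ^ e) ''
                (Ideal.span (Set.range s) : Set (Localization.AtPrime Q)))) → y ∈ Ideal.span (Set.range s)) →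
      ∃ (X' : Scheme.{0}) (π : X' ⟶ Spec (.of (MvPolynomial (Fin n) k ⧸ Ideal.span {f}))), IsProper π ∧
        Literature.AlgebraicGeometry.Resolution.IsBirational π ∧
        ∀ y : X', IsDomain (X'.presheaf.stalk y) ∧ ∀ d : ℕ, ringKrullDim (X'.presheaf.stalk y) = d →
          ∀ s : Fin d → X'.presheaf.stalk y, (Ideal.span (Set.range s)).radical.IsMaximal →
            RingTheory.Sequence.IsWeaklyRegular (X'.presheaf.stalk y) (List.ofFn s) ∧
            ∀ z : X'.presheaf.stalk y, (∃ e : ℕ, z ^ p ^ e ∈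
                Ideal.span ((fun w : X'.presheaf.stalk y => w ^ p ^ e) ''
                  (Ideal.span (Set.range s) : Set (X'.presheaf.stalk y)))) →
              z ∈ Ideal.span (Set.range s)) :
    ∀ (k : Type) [Field k] [CharP k 5] (h : MvPolynomial (Fin 4) k),
      h = MvPolynomial.X 2 ^ 2 + MvPolynomial.X 3 ^ 2 * (MvPolynomial.X 1 ^ 6 + MvPolynomial.X 0 ^ 3) +
        MvPolynomial.X 0 ^ 2 * MvPolynomial.X 3 ^ 3 →
      ∃ (X' : Scheme.{0}) (π : X' ⟶ Spec (.of (MvPolynomial (Fin 4) k ⧸ Ideal.span {h}))), IsProper π ∧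
        Literature.AlgebraicGeometry.Resolution.IsBirational π ∧
        ∀ y : X', IsDomain (X'.presheaf.stalk y) ∧ ∀ d : ℕ, ringKrullDim (X'.presheaf.stalk y) = d →
          ∀ s : Fin d → X'.presheaf.stalk y, (Ideal.span (Set.range s)).radical.IsMaximal →
            RingTheory.Sequence.IsWeaklyRegular (X'.presheaf.stalk y) (List.ofFn s) ∧
            ∀ z : X'.presheaf.stalk y, (∃ e : ℕ, z ^ 5 ^ e ∈
                Ideal.span ((fun w : X'.presheaf.stalk y => w ^ 5 ^ e) ''
                  (Ideal.span (Set.range s) : Set (X'.presheaf.stalk y)))) →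
              z ∈ Ideal.span (Set.range s) := by
  intro k _ _ h hh
  haveI : Fact (Nat.Prime 5) := ⟨Nat.prime_five⟩
  refine hG5 5 k 4 ![2, 1, 5, 2] 10 10 ![5, 10, 2, 5] (by norm_num) (by decide)
    (HWeightedData.hVeroneseSplitting k) h ?_ (HWeightedData.span_h_isPrime k h hh) (HWeightedData.h_X_ne_zero k h hh)
    (h_offOrigin_clause_char5 k h hh)
  rw [hh]
  exact HWeightedData.h_isWeightedHomogeneous k

/-- **`h = X₂² + X₃²(X₁⁶ + X₀³) + X₀²X₃³` AT `p = 5` IN ONE WEIGHTED BLOW-UP — UNCONDITIONAL** (G6c; the graded engine G5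
`GradedConeFiModel.stub_gradedConeFiModel` has LANDED, p488729): over every field of characteristic `5`, tri-2's threefold point — singular
along a plane and a line, wild weight `w₂ = 5 = p` — has a proper birational model (the `(2,1,5,2)`-weighted blow-up of the origin) all of
whose stalks are domains in which every system of parameters is weakly regular and generates a Frobenius closed ideal. [folklore] -/
theorem hGradedFiModel_char5 : ∀ (k : Type) [Field k] [CharP k 5] (h : MvPolynomial (Fin 4) k),
      h = MvPolynomial.X 2 ^ 2 + MvPolynomial.X 3 ^ 2 * (MvPolynomial.X 1 ^ 6 + MvPolynomial.X 0 ^ 3) +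
        MvPolynomial.X 0 ^ 2 * MvPolynomial.X 3 ^ 3 →
      ∃ (X' : Scheme.{0}) (π : X' ⟶ Spec (.of (MvPolynomial (Fin 4) k ⧸ Ideal.span {h}))), IsProper π ∧
        Literature.AlgebraicGeometry.Resolution.IsBirational π ∧
        ∀ y : X', IsDomain (X'.presheaf.stalk y) ∧ ∀ d : ℕ, ringKrullDim (X'.presheaf.stalk y) = d →
          ∀ s : Fin d → X'.presheaf.stalk y, (Ideal.span (Set.range s)).radical.IsMaximal →
            RingTheory.Sequence.IsWeaklyRegular (X'.presheaf.stalk y) (List.ofFn s) ∧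
            ∀ z : X'.presheaf.stalk y, (∃ e : ℕ, z ^ 5 ^ e ∈
                Ideal.span ((fun w : X'.presheaf.stalk y => w ^ 5 ^ e) ''
                  (Ideal.span (Set.range s) : Set (X'.presheaf.stalk y)))) →
              z ∈ Ideal.span (Set.range s) :=
  hGradedFiModel_char5_of_gradedEngine GradedConeFiModel.stub_gradedConeFiModel

end Summit.ResolutionOfSingularities.ResolutionOfSingularities.Theorems.FInjectiveMacaulayfication.HGradedFiModel

end
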